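import Summits.NavierStokesRegularity.FluidComputer.GateBudgetLadderStepSwing
import Summits.NavierStokesRegularity.FluidComputer.GateBudgetRungSwingSharp
import HarnessLib

/-!
# GateBudget part 126 — the θ-priced rung, III: the step of the swing ladder at `k = 1` (§329)

Cell `pub-fluidc`, blueprint seat bp1 (gen 42; SPEC-INPUT-bp1 §CR(3)(b), §CS);
namespace `Summit.NavierStokesRegularity.FluidComputer.GateBudget`, headline member
`RotorKnob.rotorCircuit K K¹⁰ ε ρ` from `delayInit`, `K ≥ 16`, unit lattice `ε = K¹⁰ρ²`.
HONEST FRAMING: a low prior, high value-of-information experiment on Tao's machine paradigm;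
NOT a claim that NS blows up. Nothing here is about the Navier–Stokes equations: these are
inequalities about the five-mode toy circuit (5.5)/(5.6).

THE POINT. Part 117 §309's rung invariant `SwingRung K ε ρ X k r₀ P₁ A₀ D₀ U δ L n r θ` carries
the transfer ceiling `U` and the √-ledger slip `δ` as PARAMETERS and nowhere fixes `U ≥ 2`; the
only place part 117's step needs `U ≥ 2` is the √-ledger step (part 96 §270: `x ≥ (m + 1)/K⁹`).
With a fractional offset `x ≥ (m + γ)/K⁹` the same step holds with log coefficient `δK⁹/(1 + γ)`
(part 125 §328d), so booking the physical slip against `(1 + γ)δ/2` keeps clause 6 of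
`SwingRung` — and with it part 118's `swingRung_readout`, `run_of_step`, `IsCleanRun`,
`cleanHorizon` — LITERALLY UNCHANGED. The θ-priced ceiling (parts 124/125:
`U ≥ 1.437 + 0.224 + O(D) ≈ 1.662` instead of `2`) then enters through `hU` alone, its clock
floor `θ ≥ 273/200` being read off clause 11 at every rung (part 125 §328d).

* the three arithmetic ingredients `ladder_balance_numerics_sharp`, `ladder_clock_floor_sharp`,
  `sqrt_ledger_step_gamma` live in part 125 §328d.
* §329 `knob_ladder_step_sharp` — THE θ-PRICED STEP (statement of part 117 §310 with `hU`,
  `hU2`, `hδ` replaced as above; conclusion identical: a rung of index `m + 1` at `r' ≥ r + 1`).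

WHAT THIS SAYS (and does not). The clean run of part 118 §312 re-run over this step with
`u = 1.662/K⁹` in place of `2/K⁹` (part 127 §331) has floor `0.076K⁹` clean misfires (part 128
§332) against part 118's `0.065K⁹` and the ceiling `0.1132K⁹ + 1` (part 119). HONEST LIMITS:
(i) `k = 1`; (ii) existence of a next rung, no uniqueness; (iii) the separation `r' ≥ r + 1` is
part 87's crude one (the clock charges at rate `≤ ε`, part 72 §220 `clock_charge_le`, would give
`r' - T' ≥ θ' + (31/32)θ ≥ 2.46` — untyped here); (iv) nothing about NS.
[cite: Tao2016AveragedNS, §5.5 Theorem 5.3, (5.5), (b-eq), (c-eq), (d-eq), (energy-con)]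
-/

noncomputable section

namespace Summit.NavierStokesRegularity.FluidComputer.GateBudget

open Real Set Filter Topology
open Literature.Analysis.FluidPDE.Tao2016AveragedNS

variable {K M ε ρ : ℝ} {X : ℝ → Fin 5 → ℝ} {C : ℝ → ℝ}

/-! ## §329 The θ-priced step of the swing ladder -/

/-- §329 **THE θ-PRICED STEP OF THE SWING LADDER AT k = 1** — part 117 §310
`knob_ladder_step_swing` RE-RUN over the SAME invariant `SwingRung` (part 117 §309) with three
changes of hypothesis and none of conclusion: (1) the transfer ceiling `hU` is part 125 §328c's
`1.437 + 0.224 + 3.05(D + D²) + 511 log K·D² ≤ U` and `hU2 : 2 ≤ U` becomes `1 + γ ≤ U` for a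
fractional offset `0 < γ ≤ 1` (so `U = 1.662`, `γ = 0.662` are admissible); (2) the ã-free slip
bound is booked against `(1 + γ)δ/2` (`hδ`), so that the √-ledger's log coefficient stays
`δK⁹/2` (part 125 §328d `sqrt_ledger_step_gamma`: with `x ≥ (m + γ)/K⁹` the per-rung log
increment is `((1 + γ)δ/2)·K⁹/(1 + γ) = δK⁹/2`) and clause 6 of `SwingRung` is unchanged;
(3) nothing else — the window `hNW` is VERBATIM. Inside, the current rung's clock floor is
read off clause 11 as `θ ≥ 273/200` (part 125 §328d `ladder_clock_floor_sharp`, numerics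
`ladder_balance_numerics_sharp`), which is what parts 124/125's sharper price needs; every
other line is part 117 §310's.
IF `1 ≤ m`, `m + 1 ≤ N` and `(r, θ)` is a rung of index `m`, THEN there is a rung `(r', θ')`
of index `m + 1` with `r' ≥ r + 1`.
[derived: part 117 §310 (proof verbatim but for the three hypotheses), part 125 §328c, part 96
§270, part 90 §261, part 92 §265, part 87 §255, part 93, part 81 §238] -/
theorem knob_ladder_step_sharp
    (hX : ∀ t, HasDerivAt X (RotorKnob.rotorCircuit K (K ^ 10) ε ρ (X t)) t)
    (h0 : X 0 = delayInit) (hC : ∀ t, HasDerivAt C (X t 2) t) (hK : 16 ≤ K)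
    (hε : 0 < ε) (hεK : ε ^ 2 ≤ 1 / (6 * K ^ 20)) (hρ : 0 < ρ)
    (hlo : 200 * ε / K ^ 20 ≤ ρ ^ 2) (hhi : K ^ 10 * ρ ^ 2 ≤ 2 * ε) (k : ℕ)
    (hk : ε = k * K ^ 10 * ρ ^ 2) (hkone : k = 1) {r₀ P₁ A₀ D₀ D U δ L γ : ℝ} {N : ℕ}
    (hr₀ : 0 ≤ r₀) (hP₁ : X r₀ 3 ^ 2 + X r₀ 4 ^ 2 ≤ P₁)
    (hL42 : L ≤ 42 / K ^ 9) (hN9 : (N : ℝ) - 1 ≤ K ^ 9)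
    (hA0 : 0 ≤ A₀) (hD₀ : |X r₀ 3| ≤ D₀)
    (hD : D₀ + (1 + 10 / 9 * K ^ 4) * ((61 / 12 * k + 2 / 3) / K ^ 10 + 3 / K ^ 9) ≤ D)
    (hU : 1437 / 1000 + 224 / 1000 + 305 / 100 * (D + D ^ 2) + 511 * log K * D ^ 2 ≤ U)
    (hγ0 : 0 < γ) (hγ1 : γ ≤ 1) (hUγ : 1 + γ ≤ U)
    (hδ : (2 * D + (2 * k + 3) / (5 * K ^ 9)) * ((2 * k + 3) / (5 * K ^ 9))
      + 6 * (D + (2 * k + 3) / (5 * K ^ 9) + 3 / K ^ 9) / K ^ 9 ≤ (1 + γ) / 2 * δ)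
    (hL : 242 * log K / K ^ 10 + 37 * (D + (2 * k + 3) / (5 * K ^ 9) + 4 / K ^ 9) / K ^ 9 ≤ L)
    (hNW : (√P₁ + ((N : ℝ) - 1) * (U / K ^ 9) + δ * K ^ 9 / 2 * log N) ^ 2
      + (3 * (k * π / ((25 / 16 - 1 / 10 ^ 6) * K ^ 10 - 1) + 1 / K ^ 19
      + 310 * log K / K ^ 9) / 10 + 6 / K ^ 9) + δ ≤ 1 / 50)
    {m : ℕ} (hm : 1 ≤ m) (hmN : m + 1 ≤ N) {r θ : ℝ}
    (hrung : SwingRung K ε ρ X k r₀ P₁ A₀ D₀ U δ L m r θ) :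
    ∃ r' θ' : ℝ, r + 1 ≤ r' ∧ SwingRung K ε ρ X k r₀ P₁ A₀ D₀ U δ L (m + 1) r' θ' := by
  unfold SwingRung at hrung ⊢
  obtain ⟨hk1, -, -, hδ0, -, -⟩ := rung_numerics hK hε hρ hlo k hk
  have hK0 : (0 : ℝ) < K := by linarith
  have hK8 : (0 : ℝ) < K ^ 8 := by positivity
  have hK9 : (0 : ℝ) < K ^ 9 := by positivity
  have hK10 : (0 : ℝ) < K ^ 10 := by positivity
  have hk0 : (0 : ℝ) ≤ k := Nat.cast_nonneg k
  have hlogK : 0 ≤ log K := Real.log_nonneg (by linarith)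
  have h310 : (0 : ℝ) ≤ 310 * log K / K ^ 9 := div_nonneg (mul_nonneg (by norm_num) hlogK) hK9.le
  have h6 : (0 : ℝ) ≤ 6 / K ^ 9 := by positivity
  have h3 : (0 : ℝ) ≤ 3 / K ^ 9 := by positivity
  have hD0 : 0 ≤ D₀ := le_trans (abs_nonneg _) hD₀
  obtain ⟨s, hs_def⟩ : ∃ s : ℝ, s = 3 * (k * π / ((25 / 16 - 1 / 10 ^ 6) * K ^ 10 - 1)
      + 1 / K ^ 19 + 310 * log K / K ^ 9) / 10 + 6 / K ^ 9 := ⟨_, rfl⟩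
  have hs0 : 0 ≤ s := by rw [hs_def]; linarith only [hδ0, h310, h6]
  obtain ⟨J, hJ_def⟩ : ∃ J : ℝ, J = (61 / 12 * k + 2 / 3) / K ^ 10 + 3 / K ^ 9 := ⟨_, rfl⟩
  have hJ0 : 0 ≤ J := by rw [hJ_def]; positivity
  obtain ⟨ι, hι_def⟩ : ∃ ι : ℝ, ι = (2 * k + 3) / (5 * K ^ 9) := ⟨_, rfl⟩
  have hι0 : 0 ≤ ι := by rw [hι_def]; positivity
  obtain ⟨u, hu_def⟩ : ∃ u : ℝ, u = U / K ^ 9 := ⟨_, rfl⟩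
  obtain ⟨cL, hcL_def⟩ : ∃ cL : ℝ, cL = δ * K ^ 9 / 2 := ⟨_, rfl⟩
  have hDnn : 0 ≤ D := by
    have : 0 ≤ (1 + 10 / 9 * K ^ 4) * ((61 / 12 * k + 2 / 3) / K ^ 10 + 3 / K ^ 9) := by
      positivity
    linarith only [hD0, this, hD]
  have hU0 : 0 ≤ U := by linarith only [hUγ, hγ0]
  obtain ⟨hfine0, hfine6, -, hl0⟩ := sharp_clock_signs hK hDnn
    (by positivity : (0 : ℝ) ≤ (2 * k + 3) / (5 * K ^ 9)) hL
  have hu0 : 0 ≤ u := by rw [hu_def]; exact div_nonneg hU0 hK9.le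
  have huγ : (1 + γ) / K ^ 9 ≤ u := by rw [hu_def]; exact div_le_div_of_nonneg_right hUγ hK9.le
  obtain ⟨A, hA_def⟩ : ∃ A : ℝ, A = 723 * log K / K ^ 10 + 1972 / 1000 := ⟨_, rfl⟩
  obtain ⟨c, hc_def⟩ : ∃ c : ℝ,
      c = 21 * ε ^ 2 + 1 / (10 ^ 6 * K ^ 10) + 1 / K ^ 18 + 6 / K ^ 40 := ⟨_, rfl⟩
  obtain ⟨hA723, hc0, -⟩ := ladder_balance_numerics hK hεK le_rfl hK9.le hL42
  rw [← hc_def] at hc0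
  have hApos : 0 ≤ A := by rw [hA_def]; linarith only [hA723]
  have hLs : L ≤ 1 / 10 ^ 6 := by
    have hK9' : (16 : ℝ) ^ 9 ≤ K ^ 9 := pow_le_pow_left₀ (by norm_num) hK 9
    have h1 : 42 / K ^ 9 ≤ 42 / 16 ^ 9 := div_le_div_of_nonneg_left (by norm_num) (by norm_num) hK9'
    norm_num at h1
    linarith only [hL42, h1]
  have numer : ∀ m' : ℝ, 0 ≤ m' → m' ≤ K ^ 9 →
      25 / 16 + (A * (1 / 50) + (3 + 1 / 10 ^ 6) * (1415 / 10000) / K) + m' * c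
        ≤ (139 / 100) ^ 2 - 278 / 100 * L := by
    intro m' h0' h9'
    have := (ladder_balance_numerics hK hεK h0' h9' hL42).2.2
    rwa [← hA_def, ← hc_def] at this
  have floor : ∀ {θ e m' : ℝ},
      (139 / 100) ^ 2 - 278 / 100 * L ≤ min (θ ^ 2) ((139 / 100) ^ 2)
        + (A * e ^ 2 + (3 + 1 / 10 ^ 6) * e / K) + m' * c →
      25 / 16 + (A * (1 / 50) + (3 + 1 / 10 ^ 6) * (1415 / 10000) / K) + m' * c
        ≤ (139 / 100) ^ 2 - 278 / 100 * L →
      0 < θ → 0 ≤ e → e ^ 2 ≤ 1 / 50 → 5 / 4 ≤ θ := by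
    intro θ e m' hinv hnum hθ he he2
    rw [hA_def, hc_def] at hinv hnum
    exact ladder_clock_floor hK hinv hnum hA723 hθ he he2
  simp only [← hs_def, ← hJ_def, ← hι_def, ← hA_def, ← hc_def, ← hu_def, ← hcL_def]
    at hNW hD hδ hL hrung ⊢
  have hcold6 : 0 ≤ 6 * (D + ι + 3 / K ^ 9) / K ^ 9 :=
    div_nonneg (mul_nonneg (by norm_num) (by linarith only [hDnn, hι0, h3])) hK9.le
  have h2Dι : 0 ≤ (2 * D + ι) * ι := mul_nonneg (by linarith only [hDnn, hι0]) hι0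
  have hγ2 : 0 < (1 + γ) / 2 := by positivity
  have hδ2pos : 0 ≤ (1 + γ) / 2 * δ := by linarith only [hδ, hcold6, h2Dι]
  have hδpos : 0 ≤ δ := le_of_mul_le_mul_left (by linarith only [hδ2pos]) hγ2
  have hδγ : (1 + γ) / 2 * δ ≤ δ := by nlinarith only [hγ1, hδpos]
  have hcL0 : 0 ≤ cL := by rw [hcL_def]; positivity
  have hP₁0 : 0 ≤ P₁ := le_trans (by positivity) hP₁
  have hWmono : ∀ n' : ℝ, 1 ≤ n' → n' ≤ N →
      √P₁ + (n' - 1) * u + cL * log n' ≤ √P₁ + ((N : ℝ) - 1) * u + cL * log N :=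
    fun n' h1 h2 => pair_window_mono hu0 hcL0 h1 h2
  obtain ⟨hr, hb, hθ1, hθhi, hc, hW, hP50, hA, hd1, hd2, hinv⟩ := hrung
  have hm1 : (1 : ℝ) ≤ m := by exact_mod_cast hm
  have hmN' : (m : ℝ) + 1 ≤ N := by exact_mod_cast hmN
  have hmK9 : (m : ℝ) ≤ K ^ 9 := by linarith only [hmN', hN9]
  have hr0 : 0 ≤ r := by linarith only [hr₀, hr, hm1]
  have hPr : X r 3 ^ 2 + X r 4 ^ 2 + 3 * (k * π / ((25 / 16 - 1 / 10 ^ 6) * K ^ 10 - 1)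
      + 1 / K ^ 19 + 310 * log K / K ^ 9) / 10 + 6 / K ^ 9 ≤ 1 / 50 := by
    have h := hP50; rw [hs_def] at h; linarith only [h]
  obtain ⟨T', θ₁, ⟨hrT, hτ, hτf, hcpos, hbT, hθ₁lo, hθ₁hi, hfloor, hcT, hpin, he0, hecr, hfl, -,
      hdT⟩, hΛlo, hΛhi, hdebit⟩ :=
    knob_pulse_debit hX h0 hC hK hε hεK hρ hlo hhi k hk hr0 hθ1 hθhi hb hc hPr
  have hT'0 : 0 ≤ T' := by linarith only [hr0, hrT]
  have em1 : ((m : ℝ) - 1) + 1 = m := by ring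
  have hdD : |X r 3| ≤ D :=
    (ledger_invariant_final hK0 hJ0 (by linarith only [hm1]) hd1 (by rw [em1]; exact hd2)).trans
      hD
  have ha0 : 0 ≤ X r 4 :=
    le_trans (add_nonneg hA0 (div_nonneg (by linarith only [hm1]) hK9.le)) hA
  have haP : X r 4 ^ 2 ≤ 1 / 50 := by nlinarith only [hP50, hs0, sq_nonneg (X r 3)]
  -- THE SHARP CLOCK FLOOR OF THE CURRENT RUNG from clause 11 ALONE (part 125 §328d): `θ ≥ 273/200`
  have hθs : 273 / 200 ≤ θ := by
    have hinv' := hinv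
    rw [hA_def, hc_def] at hinv'
    exact ladder_clock_floor_sharp hK hinv'
      (ladder_balance_numerics_sharp hK hεK (by linarith only [hm1]) (by linarith only [hmK9])
        hL42).2.2 hA723 (by linarith only [hθ1]) ha0 haP
  have heT : K * X T' 4 ≤ 3 / 20 * K := by
    have h2a : X r 4 ≤ 1415 / 10000 := by nlinarith only [haP, ha0]
    have : X T' 4 ≤ 3 / 20 := by linarith only [hecr, pulse_gain_crude hK, h2a]
    nlinarith only [this, hK0]
  obtain ⟨-, hι⟩ := iota_numerics hK hk0 (mul_nonneg hK0.le he0) heT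
  rw [← hι_def] at hι
  have hdT' : |X T' 3| ≤ |X r 3| + ι := by linarith only [hdT, hι]
  -- THE θ-PRICED CEILING OF THE RUNG (part 125 §328c) in place of part 106 §288c
  have hkR : (k : ℝ) = 1 := by exact_mod_cast hkone
  have hlat : ε = K ^ 10 * ρ ^ 2 := by rw [hk, hkR, one_mul]
  simp only [hkR, one_mul] at hpin
  have haT' : X T' 4 ≤ X r 4 + u := by
    rw [hu_def]
    exact knob_pulse_ceiling_swing_ladder_sharp hX h0 hC hK hε hεK hρ hlat hr0 hrT.le hτ hτf hθs
      (hθhi.trans (by norm_num)) hb hc (by linarith only [hP50, hs0]) hcpos hbT hθ₁lo hpin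
      hdD hU
  have haa' : X r 4 ≤ X T' 4 := by
    have : (0 : ℝ) < 1 / K ^ 9 := by positivity
    linarith only [hfl, this]
  -- THE SQUARE-ROOT PULSE SLIP (part 96 §270) in place of part 82 §239's linear one
  have slip := pulse_pslip_sqrt ha0 haT' haa' hdT' hdD hι0
  have hxm : ((m : ℝ) + γ) / K ^ 9 ≤ √(X r 3 ^ 2 + X r 4 ^ 2) + u := by
    have h1 := output_le_sqrt_pair (d := X r 3) ha0
    have e : ((m : ℝ) + γ) / K ^ 9 = ((m : ℝ) - 1) / K ^ 9 + (1 + γ) / K ^ 9 := by ring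
    linarith only [h1, hA, hA0, huγ, e]
  have hlogm : log (m : ℝ) ≤ log ((m : ℝ) + 1) :=
    Real.log_le_log (by linarith only [hm1]) (by linarith only [hm1])
  have hWm1 : √(X r 3 ^ 2 + X r 4 ^ 2) + u
      ≤ √P₁ + ((m : ℝ) + 1 - 1) * u + cL * log ((m : ℝ) + 1) := by
    have := mul_le_mul_of_nonneg_left hlogm hcL0
    linarith only [hW, this]
  have hWN := hWmono ((m : ℝ) + 1) (by linarith only [hm1]) hmN'
  have hx0 : 0 ≤ √(X r 3 ^ 2 + X r 4 ^ 2) + u := add_nonneg (Real.sqrt_nonneg _) hu0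
  have hx2 : (√(X r 3 ^ 2 + X r 4 ^ 2) + u) ^ 2
      ≤ (√P₁ + ((N : ℝ) - 1) * u + cL * log N) ^ 2 :=
    pow_le_pow_left₀ hx0 (hWm1.trans hWN) 2
  have hPT : X T' 3 ^ 2 + X T' 4 ^ 2 ≤ 1 / 50 := by
    linarith only [slip, hδ, hδγ, hcold6, hx2, hNW, hs0]
  have hθ₁1 : 1249 / 1000 ≤ θ₁ := by linarith only [hθ₁lo, hθ1, hfine6]
  have hθ₁2 : θ₁ ≤ 3 / 2 := by linarith only [hθ₁hi, hθhi, hfine6]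
  have h37 : 37 * (|X T' 3| + 4 / K ^ 9) / K ^ 9 ≤ L := by
    have h := div_le_div_of_nonneg_right (show 37 * (|X T' 3| + 4 / K ^ 9)
      ≤ 37 * (D + ι + 4 / K ^ 9) by linarith only [hdT', hdD]) hK9.le
    linarith only [h, hL, hfine0]
  -- THE COLD HALF (part 92 §265 in the credit band, else part 87 §255) + part 93's invariant
  obtain ⟨tz, r', θ', ⟨htz1, -, htz2, hr'3, hcold, hc'⟩, ⟨hb', hθ'hi, hθ'lo, hpair⟩,
      ⟨-, hdr', hmono, -, -⟩, hclk⟩ :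
      ∃ tz r' θ' : ℝ, (T' + 1 ≤ tz ∧ X tz 1 = 0 ∧ tz < r' ∧ r' < T' + 3 ∧
        (∀ t ∈ Icc T' r', X t 2 ≤ ρ ^ 2 / K ^ 9) ∧ X r' 2 = ρ ^ 2 / K ^ 9) ∧
        (X r' 1 = θ' * ε ∧ θ' ≤ 141422 / 100000 ∧
          (θ₁ - 37 * (|X T' 3| + 4 / K ^ 9) / K ^ 9 ≤ θ' ∨ 139999 / 100000 ≤ θ') ∧
          |X r' 3 ^ 2 + X r' 4 ^ 2 - (X T' 3 ^ 2 + X T' 4 ^ 2)|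
            ≤ 6 * (|X T' 3| + 3 / K ^ 9) / K ^ 9) ∧
        (9 / 4 ≤ r' - T' ∧ |X r' 3| ≤ |X T' 3| * exp (-(9 / 4 * (K * X T' 4))) + 3 / K ^ 9 ∧
          X T' 4 ≤ X r' 4 ∧ X r' 4 ≤ X T' 4 + 3 * K * (|X T' 3| + 3 / K ^ 9) ^ 2 ∧
          ∀ t ∈ Icc T' r', |X t 3| ≤ |X T' 3| + 3 / K ^ 9) ∧
        (139 / 100) ^ 2 - 278 / 100 * L ≤ min (θ' ^ 2) ((139 / 100) ^ 2)
          + (A * X r' 4 ^ 2 + (3 + 1 / 10 ^ 6) * X r' 4 / K) + (m : ℝ) * c := by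
    rcases le_or_gt θ₁ (139 / 100) with hband | hband
    · obtain ⟨tz, r', θ', h1, h2, h3, -, -, hcredit⟩ :=
        knob_cold_credit hX h0 hK hε hεK hρ hhi hT'0 hθ₁1 hband hbT hPT hfloor hcT he0
      refine ⟨tz, r', θ', h1, h2, h3, ?_⟩
      have hmo : X T' 4 ≤ X r' 4 := h3.2.2.1
      have hbal := rung_balance_in_band hK hdebit hcredit hΛlo hΛhi ha0 haa' hmo
      have hFm := balance_weight_mono hK ha0 (haa'.trans hmo) hc0
      rw [← hA_def, ← hc_def] at hbal
      rw [← hA_def] at hFm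
      have step := capped_step_in_band (C := ((139 : ℝ) / 100) ^ 2) (θ2 := θ ^ 2)
        (θ'2 := θ' ^ 2)
        (F := A * X r 4 ^ 2 + (3 + 1 / 10 ^ 6) * X r 4 / K + ((m : ℝ) - 1) * c)
        (F' := A * X r' 4 ^ 2 + (3 + 1 / 10 ^ 6) * X r' 4 / K + (m : ℝ) * c)
        (by linarith only [hbal]) (by linarith only [hFm])
      linarith only [step, hinv]
    · obtain ⟨tz, r', θ', h1, h2, h3⟩ :=
        knob_cold_half_sharp hX h0 hK hε hεK hρ hhi hT'0 hθ₁1 hθ₁2 hbT hPT hfloor hcT he0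
      refine ⟨tz, r', θ', h1, h2, h3, ?_⟩
      have hθ'L := out_band_floor hband hl0 h37 h2.2.2.1
      have he'0 : 0 ≤ X r' 4 := ha0.trans (haa'.trans h3.2.2.1)
      have hF' : 0 ≤ A * X r' 4 ^ 2 + (3 + 1 / 10 ^ 6) * X r' 4 / K + (m : ℝ) * c :=
        add_nonneg (add_nonneg (mul_nonneg hApos (sq_nonneg _))
          (div_nonneg (mul_nonneg (by norm_num) he'0) hK0.le))
          (mul_nonneg (by linarith only [hm1]) hc0)
      have := capped_step_out_band hl0 (by linarith only [hLs]) hθ'L hF'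
      linarith only [this]
  have hθ'pos : 0 < θ' := rung_exit_pos hθ₁1 (by linarith only [h37, hLs]) hθ'lo
  -- THE PAIR SLIP OF THE RUNG ON THE √P LEDGER (part 96 §270): `P(r') ≤ x² + δ`
  have hcold' : 6 * (|X T' 3| + 3 / K ^ 9) / K ^ 9 ≤ 6 * (D + ι + 3 / K ^ 9) / K ^ 9 :=
    div_le_div_of_nonneg_right (by linarith only [hdT', hdD]) hK9.le
  have hP'x : X r' 3 ^ 2 + X r' 4 ^ 2 ≤ (√(X r 3 ^ 2 + X r 4 ^ 2) + u) ^ 2 + (1 + γ) / 2 * δ := by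
    have h1 := (abs_le.1 hpair).2
    linarith only [h1, hcold', slip, hδ]
  have hstep := sqrt_ledger_step_gamma hK9 hm1 hδ2pos hγ0 hγ1 hxm hP'x
  have ecL : (1 + γ) / 2 * δ * K ^ 9 / (1 + γ) = cL := by
    rw [hcL_def, div_eq_iff (by positivity : (1 + γ : ℝ) ≠ 0)]
    ring
  rw [ecL] at hstep
  obtain ⟨x, hx⟩ : ∃ x : ℝ, x = K * X T' 4 := ⟨_, rfl⟩
  have hmK : (m : ℝ) / K ^ 9 ≤ X T' 4 := by
    have e : ((m : ℝ) - 1) / K ^ 9 + 1 / K ^ 9 = (m : ℝ) / K ^ 9 := by ring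
    linarith only [hA, hfl, hA0, e]
  have hxm' : (m : ℝ) / K ^ 8 ≤ x := by
    have e : K * ((m : ℝ) / K ^ 9) = (m : ℝ) / K ^ 8 := by field_simp
    rw [hx, ← e]; exact mul_le_mul_of_nonneg_left hmK hK0.le
  have hx0' : 0 ≤ x := le_trans (by positivity) hxm'
  have hq0 : 0 ≤ exp (-(9 / 4 * x)) := (exp_pos _).le
  have hq1 : exp (-(9 / 4 * x)) ≤ 1 := by rw [Real.exp_le_one_iff]; linarith only [hx0']
  have hinj : exp (-(9 / 4 * x)) * (5 * k + (k / 2 + 4) * x) ≤ 61 / 12 * k + 2 / 3 := by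
    have f1 := mul_le_of_le_one_left (by positivity : (0 : ℝ) ≤ 5 * k) hq1
    have f2 := mul_le_mul_of_nonneg_left (injection_numerics x)
      (by positivity : (0 : ℝ) ≤ k / 2 + 4)
    linarith only [f1, f2]
  have hinj' : exp (-(9 / 4 * x)) * ((5 * k + (k / 2 + 4) * x) / K ^ 10)
      ≤ (61 / 12 * k + 2 / 3) / K ^ 10 := by
    rw [← mul_div_assoc]; exact div_le_div_of_nonneg_right hinj hK10.le
  rw [← hx] at hdT hdr'
  have hprod := mul_le_mul_of_nonneg_right hdT hq0
  have hrec : |X r' 3| ≤ exp (-(9 / 4 * x)) * |X r 3| + J := by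
    rw [hJ_def]; linarith only [hdr', hprod, hinj']
  have hy : 9 / 4 * (((m : ℝ) - 1) + 1) / K ^ 8 ≤ 9 / 4 * x := by
    rw [em1, mul_div_assoc]; linarith only [hxm']
  obtain ⟨hd1', hd2'⟩ := ledger_invariant_step hK0 hJ0 hD0 (abs_nonneg _)
    (by linarith only [hm1]) hy hd1 (by rw [em1]; exact hd2) hrec
  have em : ((m : ℝ) - 1) + 2 = (m : ℝ) + 1 := by ring
  rw [em] at hd2'
  -- the clock floor of the next rung from the invariant ALONE (part 93 §267)
  have he'0 : 0 ≤ X r' 4 := ha0.trans (haa'.trans hmono)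
  have hPr'50 : X r' 3 ^ 2 + X r' 4 ^ 2 + s ≤ 1 / 50 := by
    linarith only [hP'x, hx2, hNW, hδγ]
  have he'2 : X r' 4 ^ 2 ≤ 1 / 50 := by
    nlinarith only [hPr'50, hs0, sq_nonneg (X r' 3)]
  have hθ'1 : 5 / 4 ≤ θ' := floor hclk (numer m (by positivity) hmK9) hθ'pos he'0 he'2
  refine ⟨r', θ', by linarith only [hrT, htz1, htz2], ?_, hb', hθ'1, by linarith only [hθ'hi],
    hc', ?_, hPr'50, ?_, ?_, ?_, ?_⟩
  · push_cast; linarith only [hr, hrT, htz1, htz2]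
  · push_cast; linarith only [hstep, hW]
  · have e' : (((m + 1 : ℕ) : ℝ) - 1) / K ^ 9 = ((m : ℝ) - 1) / K ^ 9 + 1 / K ^ 9 := by
      push_cast; ring
    linarith only [hA, hfl, hmono, e']
  · push_cast; linarith only [hd1']
  · push_cast; exact hd2'
  · push_cast
    have e' : ((m : ℝ) + 1 - 1) * c = (m : ℝ) * c := by ring
    rw [e']; exact hclk

end Summit.NavierStokesRegularity.FluidComputer.GateBudget
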